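import Mathlib
import Summits.NavierStokesRegularity.NavierStokesRegularity.Theorems.EulerZoomLiouvillePowerGaugeEulerLiouvilleSelfSimilarNoDriftBadNode
import Summits.NavierStokesRegularity.NavierStokesRegularity.Theorems.EulerZoomLiouvillePowerGaugeEulerLiouvilleSelfSimilarLimitSetKill
import Summits.NavierStokesRegularity.NavierStokesRegularity.Theorems.EulerZoomLiouvillePowerGaugeEulerLiouvilleSelfSimilarNoDriftNoPressure
import Literature.LinearAlgebra.BorderedKernelInvertible
import HarnessLib.Audit

/-!
# Rung C1 of the crux `EulerZoomLiouville.PowerGaugeEulerLiouville`, NO-DRIFT lane: EVERY VORTICAL PARTICLE'S BACKWARD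
# TRAJECTORY CONVERGES TO ONE BAD STAGNATION POINT — bounded profiles, WITHOUT the pressure normalisation `P ≤ P₀`

Route №10 `EulerZoomLiouville` (NavierStokesRegularity), crux E = stmt-NavierStokesRegularity-19832, tenure rung C1,
registered residue `stub_selfSimilarExtremalRest`.  Lineage ns-typeII-p2 (gen 8).  Sequel of
`…SelfSimilarBoundedConfinement` and `…SelfSimilarNoDriftNoPressure`: the bad-node analysis of `…SelfSimilarNoDriftBadNode`
(gen 7, p569629) and the bounded-profile convergence theorem of `…SelfSimilarNoDriftBounded` (p570659), re-run on the
pressure-free backward-trajectory kit.  Setting: `0 < γ < ½`, `V` smooth, `‖V‖ ≤ M`, `‖DV‖ ≤ K`, `(V, P)` a self-similar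
Euler profile (CIV (3.3)); NO hypothesis on `P`.

* `tendsto_flow_atBot_of_nonvortical_badClusterPt'`, `tendsto_flow_atBot_of_vortical_clusterPt'`,
  `tendsto_flow_atBot_of_badClusterPt'` — no drift at a bad limit node (the vortical case now cites the canonical
  `Literature.LinearAlgebra.exists_borderedEquiv_of_vortical_node`, hygiene flag C275);
* **`tendsto_flow_atBot_of_curl_ne_zero_of_bounded'`** — the backward trajectory of EVERY vortical point converges to
  ONE bad stagnation point; no far field, no pressure normalisation, no hypothesis on the stagnation set.

WHAT THIS IS NOT: not NS, not E, not rung C1 — classical bounded profiles.  [folklore; ConstantinIgnatovaVicol2026Putative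
§3.5 (setting)]
-/

noncomputable section

-- flat `Theorems/<Route><Decl>…` files of one crux share the namespace of the crux (tree convention)
set_option linter.dupNamespace false

open MeasureTheory Set Filter Topology Metric Function InnerProductSpace
open scoped RealInnerProductSpace NNReal ContDiff

namespace Summit.NavierStokesRegularity.NavierStokesRegularity.Theorems.PowerGaugeEulerLiouville.NoDrift

open Literature.Analysis Literature.Analysis.FluidPDE
open Summit.NavierStokesRegularity.NavierStokesRegularity.Theorems.PowerGaugeEulerLiouville.Kelvin

variable {γ : ℝ} {V : EuclideanSpace ℝ (Fin 3) → EuclideanSpace ℝ (Fin 3)} {P : EuclideanSpace ℝ (Fin 3) → ℝ}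

/-- **NO DRIFT AT A NON-VORTICAL BAD LIMIT NODE — pressure-free form.**  `0 < γ < ½`, `V` smooth with `‖V‖ ≤ M`,
`‖DV‖ ≤ K` (NO condition on `P`), `(V, P)` a self-similar Euler profile.  If a backward limit point `z₀` of `x` is a
NON-VORTICAL (`curl V z₀ = 0`) BAD (`⟪DV(z₀) w, w⟫ ≥ 1`, `‖w‖ = 1`) node, the backward trajectory of `x` converges to a
stagnation point (isolated node: preconnected limit set; non-isolated: `DW(z₀)` symmetric with trace `3γ < 1 + γ ≤` top
eigenvalue ⇒ simple kernel ⇒ bordered invertibility ⇒ `tendsto_flow_atBot_of_bordered_clusterPt'`).  Proof verbatim from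
`tendsto_flow_atBot_of_nonvortical_badClusterPt` on the pressure-free kit.
[folklore; ConstantinIgnatovaVicol2026Putative §3.5 proof of Prop. 3.9 (∇U = 𝕊 at a non-vortical node)] -/
theorem tendsto_flow_atBot_of_nonvortical_badClusterPt' (hV : ContDiff ℝ ∞ V) {K : ℝ}
    (hK : ∀ y, ‖fderiv ℝ V y‖ ≤ K) (hprof : IsSelfSimilarEulerProfile γ 0 V P) {M : ℝ} (hM : ∀ y, ‖V y‖ ≤ M)
    (hγ : 0 < γ) (hγ2 : γ < 1 / 2) (x : EuclideanSpace ℝ (Fin 3))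
    {z₀ : EuclideanSpace ℝ (Fin 3)}
    (hz₀ : MapClusterPt z₀ atBot fun s => ODE.evolutionMap (fun _ : ℝ => selfSimilarTransport γ 0 V) 0 s x)
    (hΩ : curl V z₀ = 0) {w : EuclideanSpace ℝ (Fin 3)} (hw : ‖w‖ = 1) (hbad : 1 ≤ ⟪fderiv ℝ V z₀ w, w⟫) :
    ∃ z ∈ selfSimilarNodalSet γ 0 V,
      Tendsto (fun s => ODE.evolutionMap (fun _ : ℝ => selfSimilarTransport γ 0 V) 0 s x) atBot (𝓝 z) := by
  set W := selfSimilarTransport γ 0 V with hWdef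
  set Φ := ODE.evolutionMap (fun _ : ℝ => W) 0 with hΦdef
  have hVd : Differentiable ℝ V := hV.differentiable (by simp)
  -- compact tail, continuity, limit points are nodes
  set B : ℝ := ‖x‖ + M / γ with hB
  have hKc : IsCompact (closedBall (0 : EuclideanSpace ℝ (Fin 3)) B) := isCompact_closedBall 0 B
  have htail : ∀ᶠ s in atBot, Φ s x ∈ closedBall (0 : EuclideanSpace ℝ (Fin 3)) B := by
    filter_upwards [eventually_le_atBot (0 : ℝ)] with s hs
    rw [mem_closedBall, dist_zero_right, hB]
    exact norm_flow_le_of_nonpos' hV hK hM hγ x hs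
  have hcont : Continuous fun s => Φ s x := continuous_flow_apply (γ := γ) hV hK x
  have hN : ∀ z, MapClusterPt z atBot (fun s => Φ s x) → z ∈ selfSimilarNodalSet γ 0 V :=
    fun z hz => mem_nodalSet_of_mapClusterPt_atBot' hV hK hprof hM hγ hγ2 hz
  have hz₀N : W z₀ = 0 := hN z₀ hz₀
  by_cases hiso : ∃ r : ℝ, 0 < r ∧ ∀ y ∈ selfSimilarNodalSet γ 0 V, dist y z₀ < r → y = z₀
  · obtain ⟨r, hr, hiso⟩ := hiso
    exact ⟨z₀, hN z₀ hz₀, tendsto_of_isolated_mapClusterPt hcont hKc htail hN hz₀ hr hiso⟩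
  -- non-isolated: a unit kernel vector of `DW(z₀)`
  push Not at hiso
  have hDV : fderiv ℝ W z₀ = γ • ContinuousLinearMap.id ℝ _ + fderiv ℝ V z₀ :=
    (hasFDerivAt_selfSimilarTransport (γ := γ) (c := 0) hVd z₀).fderiv
  have hWd : HasFDerivAt W (fderiv ℝ W z₀) z₀ := by
    rw [hDV]; exact hasFDerivAt_selfSimilarTransport (γ := γ) (c := 0) hVd z₀
  obtain ⟨e, he, hLe⟩ := exists_unit_kernel_of_accumulating_zeros hWd hz₀N fun r hr => by
    obtain ⟨y, hy, hdist, hne⟩ := hiso r hr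
    exact ⟨y, hne, hdist, hy⟩
  -- `DW(z₀)` is symmetric with trace `3γ` and `⟪DW w, w⟫ ≥ 1 + γ`
  have hS := isSymmetric_fderiv_of_curl_eq_zero (hVd z₀) hΩ
  have hLsym : ((fderiv ℝ W z₀ : EuclideanSpace ℝ (Fin 3) →L[ℝ] EuclideanSpace ℝ (Fin 3)) :
      EuclideanSpace ℝ (Fin 3) →ₗ[ℝ] EuclideanSpace ℝ (Fin 3)).IsSymmetric := by
    rw [hDV]
    intro u v
    have hSuv := hS u v
    simp only [ContinuousLinearMap.coe_coe] at hSuv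
    simp only [ContinuousLinearMap.coe_coe, add_apply, FunLike.coe_smul, Pi.smul_apply,
      ContinuousLinearMap.id_apply, inner_add_left, inner_add_right, real_inner_smul_left, real_inner_smul_right]
    rw [hSuv]
  have htr : LinearMap.trace ℝ _ ((fderiv ℝ W z₀ : EuclideanSpace ℝ (Fin 3) →L[ℝ] EuclideanSpace ℝ (Fin 3)) :
      EuclideanSpace ℝ (Fin 3) →ₗ[ℝ] EuclideanSpace ℝ (Fin 3)) = 3 * γ := by
    have hdiv : LinearMap.trace ℝ _ ((fderiv ℝ V z₀ : EuclideanSpace ℝ (Fin 3) →L[ℝ] EuclideanSpace ℝ (Fin 3)) :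
        EuclideanSpace ℝ (Fin 3) →ₗ[ℝ] EuclideanSpace ℝ (Fin 3)) = 0 := hprof.divFree z₀
    rw [hDV, ContinuousLinearMap.toLinearMap_add, ContinuousLinearMap.toLinearMap_smul, map_add,
      map_smul, hdiv, ContinuousLinearMap.coe_id, LinearMap.trace_id, finrank_euclideanSpace,
      Fintype.card_fin]
    norm_num [smul_eq_mul]
    ring
  have hbadW : 1 + γ ≤ ⟪fderiv ℝ W z₀ w, w⟫ := by
    rw [hDV]
    simp only [add_apply, FunLike.coe_smul, Pi.smul_apply, ContinuousLinearMap.id_apply,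
      inner_add_left, real_inner_smul_left, real_inner_self_eq_norm_sq, hw]
    linarith
  have hker := ker_inter_orth_eq_zero_of_bad hLsym hγ.le hγ2 htr hw hbadW he hLe
  obtain ⟨T, hT⟩ := exists_borderedEquiv_of_isSymmetric hLsym he hLe hker
  exact tendsto_flow_atBot_of_bordered_clusterPt' hV hK hprof hM hγ hγ2 x hz₀ he hLe T hT

/-- **NO DRIFT AT A VORTICAL LIMIT NODE — pressure-free form.**  Same setting (no condition on `P`); if a backward
limit point `z₀` of `x` is VORTICAL (`curl V z₀ ≠ 0`), the backward trajectory of `x` converges to a stagnation point: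
isolated ⇒ as before; non-isolated ⇒ `DW(z₀) Ω(z₀) = (1+γ) Ω(z₀)`, `DW(z₀) e = 0` for a unit kernel vector,
`tr DW(z₀) = 3γ`, and the CANONICAL bordered-invertibility lemma
`Literature.LinearAlgebra.exists_borderedEquiv_of_vortical_node` (typeII-lit-1, p567546 — cited here instead of the
lineage's duplicate, closing hygiene flag C275 for new consumers) feeds `tendsto_flow_atBot_of_bordered_clusterPt'`.
[cite: ConstantinIgnatovaVicol2026Putative, §3.5 proof of Thm. 3.8 (`DU(y_*)Ω(y_*) = Ω(y_*)`)] -/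
theorem tendsto_flow_atBot_of_vortical_clusterPt' (hV : ContDiff ℝ ∞ V) {K : ℝ}
    (hK : ∀ y, ‖fderiv ℝ V y‖ ≤ K) (hprof : IsSelfSimilarEulerProfile γ 0 V P) {M : ℝ} (hM : ∀ y, ‖V y‖ ≤ M)
    (hγ : 0 < γ) (hγ2 : γ < 1 / 2) (x : EuclideanSpace ℝ (Fin 3))
    {z₀ : EuclideanSpace ℝ (Fin 3)}
    (hz₀ : MapClusterPt z₀ atBot fun s => ODE.evolutionMap (fun _ : ℝ => selfSimilarTransport γ 0 V) 0 s x)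
    (hΩ : curl V z₀ ≠ 0) :
    ∃ z ∈ selfSimilarNodalSet γ 0 V,
      Tendsto (fun s => ODE.evolutionMap (fun _ : ℝ => selfSimilarTransport γ 0 V) 0 s x) atBot (𝓝 z) := by
  set W := selfSimilarTransport γ 0 V with hWdef
  set Φ := ODE.evolutionMap (fun _ : ℝ => W) 0 with hΦdef
  have hVd : Differentiable ℝ V := hV.differentiable (by simp)
  set B : ℝ := ‖x‖ + M / γ with hB
  have hKc : IsCompact (closedBall (0 : EuclideanSpace ℝ (Fin 3)) B) := isCompact_closedBall 0 B
  have htail : ∀ᶠ s in atBot, Φ s x ∈ closedBall (0 : EuclideanSpace ℝ (Fin 3)) B := by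
    filter_upwards [eventually_le_atBot (0 : ℝ)] with s hs
    rw [mem_closedBall, dist_zero_right, hB]
    exact norm_flow_le_of_nonpos' hV hK hM hγ x hs
  have hcont : Continuous fun s => Φ s x := continuous_flow_apply (γ := γ) hV hK x
  have hN : ∀ z, MapClusterPt z atBot (fun s => Φ s x) → z ∈ selfSimilarNodalSet γ 0 V :=
    fun z hz => mem_nodalSet_of_mapClusterPt_atBot' hV hK hprof hM hγ hγ2 hz
  have hz₀N : z₀ ∈ selfSimilarNodalSet γ 0 V := hN z₀ hz₀
  by_cases hiso : ∃ r : ℝ, 0 < r ∧ ∀ y ∈ selfSimilarNodalSet γ 0 V, dist y z₀ < r → y = z₀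
  · obtain ⟨r, hr, hiso⟩ := hiso
    exact ⟨z₀, hz₀N, tendsto_of_isolated_mapClusterPt hcont hKc htail hN hz₀ hr hiso⟩
  push Not at hiso
  have hDV : fderiv ℝ W z₀ = γ • ContinuousLinearMap.id ℝ _ + fderiv ℝ V z₀ :=
    (hasFDerivAt_selfSimilarTransport (γ := γ) (c := 0) hVd z₀).fderiv
  have hWd : HasFDerivAt W (fderiv ℝ W z₀) z₀ := by
    rw [hDV]; exact hasFDerivAt_selfSimilarTransport (γ := γ) (c := 0) hVd z₀
  obtain ⟨e, he, hLe⟩ := exists_unit_kernel_of_accumulating_zeros hWd hz₀N fun r hr => by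
    obtain ⟨y, hy, hdist, hne⟩ := hiso r hr
    exact ⟨y, hne, hdist, hy⟩
  -- the vorticity is an eigenvector with eigenvalue `1 + γ`
  have hAω : fderiv ℝ W z₀ (curl V z₀) = (1 + γ) • curl V z₀ := by
    rw [hDV, add_apply, FunLike.coe_smul, Pi.smul_apply, ContinuousLinearMap.id_apply,
      hprof.isSelfSimilarEulerVorticityProfile.fderiv_apply_curl_eq_of_mem_nodalSet hz₀N, add_smul, one_smul,
      add_comm]
  have htr : LinearMap.trace ℝ _ ((fderiv ℝ W z₀ : EuclideanSpace ℝ (Fin 3) →L[ℝ] EuclideanSpace ℝ (Fin 3)) :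
      EuclideanSpace ℝ (Fin 3) →ₗ[ℝ] EuclideanSpace ℝ (Fin 3)) = 3 * γ := by
    have hdiv : LinearMap.trace ℝ _ ((fderiv ℝ V z₀ : EuclideanSpace ℝ (Fin 3) →L[ℝ] EuclideanSpace ℝ (Fin 3)) :
        EuclideanSpace ℝ (Fin 3) →ₗ[ℝ] EuclideanSpace ℝ (Fin 3)) = 0 := hprof.divFree z₀
    rw [hDV, ContinuousLinearMap.toLinearMap_add, ContinuousLinearMap.toLinearMap_smul, map_add,
      map_smul, hdiv, ContinuousLinearMap.coe_id, LinearMap.trace_id, finrank_euclideanSpace,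
      Fintype.card_fin]
    norm_num [smul_eq_mul]
    ring
  obtain ⟨T, hT⟩ := Literature.LinearAlgebra.exists_borderedEquiv_of_vortical_node finrank_euclideanSpace_fin
    (fderiv ℝ W z₀) hΩ hAω he hLe htr (ne_of_lt hγ2) (by intro h; linarith)
  exact tendsto_flow_atBot_of_bordered_clusterPt' hV hK hprof hM hγ hγ2 x hz₀ he hLe T hT

/-- **NO DRIFT AT A BAD LIMIT NODE** (vortical or not) — pressure-free form. [folklore] -/
theorem tendsto_flow_atBot_of_badClusterPt' (hV : ContDiff ℝ ∞ V) {K : ℝ}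
    (hK : ∀ y, ‖fderiv ℝ V y‖ ≤ K) (hprof : IsSelfSimilarEulerProfile γ 0 V P) {M : ℝ} (hM : ∀ y, ‖V y‖ ≤ M)
    (hγ : 0 < γ) (hγ2 : γ < 1 / 2) (x : EuclideanSpace ℝ (Fin 3))
    {z₀ : EuclideanSpace ℝ (Fin 3)}
    (hz₀ : MapClusterPt z₀ atBot fun s => ODE.evolutionMap (fun _ : ℝ => selfSimilarTransport γ 0 V) 0 s x)
    {w : EuclideanSpace ℝ (Fin 3)} (hw : ‖w‖ = 1) (hbad : 1 ≤ ⟪fderiv ℝ V z₀ w, w⟫) :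
    ∃ z ∈ selfSimilarNodalSet γ 0 V,
      Tendsto (fun s => ODE.evolutionMap (fun _ : ℝ => selfSimilarTransport γ 0 V) 0 s x) atBot (𝓝 z) := by
  by_cases hΩ : curl V z₀ = 0
  · exact tendsto_flow_atBot_of_nonvortical_badClusterPt' hV hK hprof hM hγ hγ2 x hz₀ hΩ hw hbad
  · exact tendsto_flow_atBot_of_vortical_clusterPt' hV hK hprof hM hγ hγ2 x hz₀ hΩ


/-- **EVERY VORTICAL PARTICLE'S BACKWARD TRAJECTORY CONVERGES TO ONE BAD STAGNATION POINT — bounded profile, NO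
pressure hypothesis.**  `0 < γ < ½`; `(V, P)` a self-similar Euler profile (CIV (3.3)) with `V` smooth, `‖V‖ ≤ M`,
`‖DV‖ ≤ K`; `x` with `curl V x ≠ 0`.  Then `Φₛ x → z` as `s → −∞` for a stagnation point `z` carrying a unit `w` with
`⟪DV(z) w, w⟫ ≥ 1`.  (ns-typeII-p1's trajectory-level LIMIT-SET KILL `NodalContinuum.exists_mapClusterPt_stretching_ge_one`
on the backward trajectory confined by `norm_flow_le_of_nonpos'`, then `tendsto_flow_atBot_of_badClusterPt'`.)
Pressure-free form of `tendsto_flow_atBot_of_curl_ne_zero_of_bounded` (p570659). [folklore;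
ConstantinIgnatovaVicol2026Putative §3.5 Thm 3.10 (structure of backward self-similar trajectories)] -/
theorem tendsto_flow_atBot_of_curl_ne_zero_of_bounded' (hV : ContDiff ℝ ∞ V) {K : ℝ} (hK : ∀ y, ‖fderiv ℝ V y‖ ≤ K)
    (hprof : IsSelfSimilarEulerProfile γ 0 V P) {M : ℝ} (hM : ∀ y, ‖V y‖ ≤ M)
    (hγ : 0 < γ) (hγ2 : γ < 1 / 2) {x : EuclideanSpace ℝ (Fin 3)} (hx : curl V x ≠ 0) :
    ∃ z ∈ selfSimilarNodalSet γ 0 V, (∃ w : EuclideanSpace ℝ (Fin 3), ‖w‖ = 1 ∧ 1 ≤ ⟪fderiv ℝ V z w, w⟫) ∧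
      Tendsto (fun s => ODE.evolutionMap (fun _ : ℝ => selfSimilarTransport γ 0 V) 0 s x) atBot (𝓝 z) := by
  set Φ := ODE.evolutionMap (fun _ : ℝ => selfSimilarTransport γ 0 V) 0 with hΦ
  -- the backward trajectory `Y t = Φ (−t) x` is bounded for `t ≥ 0`
  set Y : ℝ → EuclideanSpace ℝ (Fin 3) := fun t => Φ (-t) x with hYdef
  have hY : ∀ t, HasDerivAt Y ((-1 : ℝ) • selfSimilarTransport γ 0 V (Y t)) t :=
    fun t => hasDerivAt_flow_neg (γ := γ) hV hK x t
  set B : ℝ := ‖x‖ + M / γ with hB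
  have hBd : ∀ t : ℝ, 0 ≤ t → ‖Y t‖ ≤ B := fun t ht =>
    norm_flow_le_of_nonpos' hV hK hM hγ x (by linarith)
  have hx0 : curl V (Y 0) ≠ 0 := by
    have h0 : Y 0 = x := by
      change Φ (-0) x = x
      rw [neg_zero, hΦ, ODE.evolutionMap_self]
    rw [h0]; exact hx
  -- p1's trajectory-level LIMIT-SET KILL
  obtain ⟨z', -, -, hcl', w, hw, hbadw⟩ :=
    NodalContinuum.exists_mapClusterPt_stretching_ge_one hprof (ne_of_lt hγ2) hY hBd hx0
  have hcl : MapClusterPt z' atBot (fun s => Φ s x) := by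
    have e : Y = (fun s => Φ s x) ∘ Neg.neg := rfl
    rw [e, mapClusterPt_comp, Filter.map_neg_atTop] at hcl'
    exact hcl'
  obtain ⟨z, hzN, hz⟩ := tendsto_flow_atBot_of_badClusterPt' hV hK hprof hM hγ hγ2 x hcl hw hbadw
  have hzz' : z' = z := eq_of_nhds_neBot (hcl.clusterPt.mono hz)
  exact ⟨z, hzN, ⟨w, hw, hzz' ▸ hbadw⟩, hz⟩

end Summit.NavierStokesRegularity.NavierStokesRegularity.Theorems.PowerGaugeEulerLiouville.NoDrift

end
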